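import Mathlib
import Literature.AlgebraicGeometry.HodgeTheory.WeilClassesBlochSeed
import Literature.AlgebraicGeometry.Hyperkaehler.BeauvilleBogomolovForm
import Summits.HodgeConjecture.HodgeConjecture.Theorems.EightfoldBlochSeedsBlochSeedDiscOnePad4CarrierOfDesign32
import HarnessLib

/-!
# Route `EightfoldBlochSeeds`, crux `BlochSeedsGeneric` (item stmt-HodgeConjecture-18880), line `pad4-cm-anchor`
# (`Cruxes/BlochSeedsGeneric/Lines/pad4_cm_anchor.lean` fb115e60acaf2337), stubs `stub_rung_pad4_seedAt` / `stub_pad4_carrier`: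
# the MINIMAL-CLAUSE form of a Bloch seed / lci carrier, the ℚ-rescaling and `K`-symmetrisation bridges for the class `h`,
# and STUB-SHAPED wrappers at general `(P, ψ, d, n)` — uniform in the discriminant `d`

HONEST FRAMING. Nothing here proves either stub, the crux `BlochSeedsGeneric`, its siblings `BlochSeedDiscOne` (18881) /
`BlochSeedDiscThree` (18882, same skeleton at `d = 3`), rung H2, HC_AV or the Hodge conjecture; nothing is constructed (no
subscheme, no bundle, no section). UNCONDITIONAL `--supports` lemmas only: no named fact is taken as a hypothesis, no definition
and no Literature fact is introduced (D-0026). Census-neutral.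

WHAT IS HERE (leafhand `leafhand-hodge-eightfoldblochseed-1-g0`, refill order 2026-08-30T22:31:52Z (1)). The registered rung stub
asks, on the PAD-4 CM anchor `S⁴(E₀)` and for EVERY `d ≥ 1`, for `(e, a, w)` and a Bloch seed `HasBlochSeedAt 4 S⁴ h_K w` for the
`K`-symmetrised hyperplane class `h_K = d·e^*a + ψ^*e^*a`. A designer delivers: a closed lci fourfold `i : Z ↪ S⁴` (ideal locally a
regular sequence of length `4`), integral (or smooth and connected), Bloch-semiregular, on which `q·h⁴ + w` is supported for THE
DESIGNER'S polarisation class `h` (a `K`-symmetric hyperplane class `e^*a`, `ψ^*h = d·h`, as produced by the tree's Segre machinery).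
This file removes, once and for every `d`, the bookkeeping between that delivery and the stub's literal signature:

* §1 **the codimension law of regular immersions is CITABLE** (`coheight_ge_of_isRegularImmersionOfCodim`): a point of the image
  of a regular immersion of codimension `n` has codimension `≥ n` in the ambient scheme (`Order.coheight`, `= dim 𝒪_{X,x}` by
  Mathlib `ringKrullDim_stalk_eq_coheight`) — every scheme, no Noetherian hypothesis: the `n` weakly regular generators localise
  to a REGULAR sequence in `𝔪_{X,x}`, and a regular sequence has length `≤` the Krull dimension
  (`length_le_supportDim_of_isRegular`, `length_le_ringKrullDim_of_isRegular`). Adapted, with the same proofs, from the crux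
  WORKFILE `Cruxes/BlochSeedDiscOne/SeedCheckerOneAnchor.lean` §14.0 (seat `hsemireg-c5c8-1`, kernel-checked there but not
  importable from `Theorems/`); credited, not claimed.
* §2 **`HasBlochSeedAt` has FOUR clauses, the carrier THREE** (`hasBlochSeedAt_iff_four`, `hasBlochSeedAt_of_four`,
  `exists_lciCarrier_of_three`): the `IsClosedImmersion` clause is part of `IsRegularImmersionOfCodim`, the codimension-of-points
  clause is §1; with `hasBlochSeedAt_of_smooth_connected` (integrality from SMOOTH ∧ CONNECTED, the landed
  `Theorems.isIntegral_of_smooth_of_connectedSpace` of the `d = 1` hand).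
* §3 **bridges on the class `h`**: `HasBlochSeedAt n P ((c : ℚ) • h) w ↔ HasBlochSeedAt n P h w` for `c ≠ 0`
  (`hasBlochSeedAt_ratSmul_iff`: `(c·h)ⁿ = cⁿ·hⁿ`, `q ↦ q·cⁿ`); for a `K`-SYMMETRIC class (`ψ^*h = d·h`, `d ≥ 1`) the stub's
  `K`-symmetrised class is `d·h + ψ^*h = 2d·h` (`symmetrised_eq_smul`), so both the seed clause and the hyperbolicity clause for
  `d·h + ψ^*h` are EQUIVALENT to the same clauses for `h` (`hasBlochSeedAt_symmetrised_iff`, `isHyperbolicWeilType_symmetrised_iff`).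
* §4 **STUB-SHAPED wrappers at general `(P, ψ, d, n)`**: `exists_seed_stubShape_of_four` (any `e, a` with the hyperbolicity of
  `h_K`, a non-zero rational Weil class `w`, and a four-clause seed for `h_K`) and `exists_seed_stubShape_of_symmetric` (the
  designer's form: `K`-symmetric `e^*a`, hyperbolicity and a Bloch seed for `e^*a` itself); at `P := pad4Anchor E₀`,
  `ψ := pad4Action E₀ ψ₀`, `n := 4` the conclusion is LITERALLY the body of `stub_rung_pad4_seedAt d hd E₀ ψ₀ hE hψ` (the skeleton's
  `symH`, `pad4Anchor`, `pad4Action` are reducible abbreviations), for every `d`; `exists_carrier_stubShape_of_three` is the same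
  for `stub_pad4_carrier` (the body of the skeleton-local `HasLciCarrierAt` spelled out, semiregularity deleted).
* (not restated) **the anchor half of the rung is INHABITED for every `d`**: the tree's
  `Theorems.pad4Anchor_hyperbolic_weilClass` (route `FirstOrderSemiregularSeeds`, file `…FirstOrderWeilSeedsEightCPad4Anchor`) gives, for
  every CM datum `(E₀, ψ₀)`, `ψ₀² = -d`, `d ≥ 1`, an embedding `e`, a rational `a ≠ 0` with `(S⁴, (ψ₀ × (−ψ₀))⁴)` HYPERBOLIC in
  half-dimension `4` for `h_K`, and a non-zero rational Weil class of type `(4,4)` — every clause of `stub_rung_pad4_seedAt` except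
  `HasBlochSeedAt` (its action binder `Ψ` is the skeleton's `pad4Action E₀ ψ₀` by `rfl`); it is cited, not re-derived, here.

WHAT IS NOT HERE = the rung itself: an integral lci fourfold `Z ⊂ S⁴(E₀)`, Bloch-semiregular, carrying `q·h_K⁴ + w` with `w ≠ 0` —
for no `d` is such a seed in print ([Markman2025SecantWeil] §1.5; Bloch, Remark (7.5)); nor the carrier sub-rung (the inputs
(L-Port) Thom–Porteous, (L-BK-deg) Kleiman–Bertini for degeneracy loci, (L-FL-deg) Fulton–Lazarsfeld connectedness and a bundle
with Weil-bearing Chern data are not in the tree by name — census of the `d = 1` hand, unchanged and uniform in `d`).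

## References

[cite: GortzWedhorn2023, Def. 19.19 and Def. 19.23] [cite: Bloch1972Semiregularity, Thm. (7.4) and Remark (7.5)]
[cite: BuchweitzFlenner2003, (8.1)] [cite: vanGeemen1994HodgeAV, Lemma 5.2 and 5.4 (5.4.1)] [cite: HatcherAT2002, §3.2]
[cite: Markman2025SurveySecant, §11.5 Step 2]
-/

noncomputable section

-- single-problem summit (Problem = Summit): the mandated namespace repeats `HodgeConjecture`.
set_option linter.dupNamespace false

open CategoryTheory AlgebraicGeometry
open Literature.AlgebraicGeometry Literature.AlgebraicGeometry.Motives Literature.AlgebraicGeometry.HodgeTheory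
open Literature.AlgebraicTopology.SingularHomology

namespace Summit.HodgeConjecture.HodgeConjecture.Theorems

universe u

/-! ## §1 The codimension law of regular immersions (citable form) -/

section CodimLaw

open RingTheory.Sequence

/-- **A regular sequence on a finite module has length `≤` the dimension of its support** (no Noetherian hypothesis):
induction on the sequence with Mathlib's `Module.supportDim_quotSMulTop_succ_le_of_notMem_minimalPrimes` (an `M`-regular element
lies in no minimal prime of `Supp M`) and `isWeaklyRegular_cons_iff`. Adapted from the crux workfile
`Cruxes/BlochSeedDiscOne/SeedCheckerOneAnchor.lean` §14.0 (not importable from `Theorems/`). [cite: GortzWedhorn2023, Def. 19.19] -/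
theorem length_le_supportDim_of_isRegular {R : Type*} [CommRing R] {M : Type*} [AddCommGroup M] [Module R M]
    [Module.Finite R M] (rs : List R) (reg : IsRegular M rs) : (rs.length : WithBot ℕ∞) ≤ Module.supportDim R M := by
  induction rs generalizing M with
  | nil =>
    have hnt : Nontrivial M := by
      have h := reg.top_ne_smul
      rw [Ideal.ofList_nil, Submodule.bot_smul] at h
      exact (Submodule.nontrivial_iff R).mp (nontrivial_of_ne _ _ h)
    have hb := (Module.supportDim_ne_bot_iff_nontrivial R M).mpr hnt
    obtain ⟨d, hd⟩ := WithBot.ne_bot_iff_exists.mp hb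
    rw [← hd, List.length_nil, Nat.cast_zero]
    calc (0 : WithBot ℕ∞) = ((0 : ℕ∞) : WithBot ℕ∞) := WithBot.coe_zero.symm
      _ ≤ (d : WithBot ℕ∞) := WithBot.coe_le_coe.mpr bot_le
  | cons x rs ih =>
    have h1 := (isWeaklyRegular_cons_iff M x rs).mp reg.toIsWeaklyRegular
    have hnt : Nontrivial (M ⧸ (Ideal.ofList (x :: rs) • ⊤ : Submodule R M)) :=
      Submodule.Quotient.nontrivial_iff.mpr reg.top_ne_smul.symm
    have hnt' : Nontrivial (QuotSMulTop x M ⧸ (Ideal.ofList rs • ⊤ : Submodule R (QuotSMulTop x M))) :=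
      (Submodule.quotOfListConsSMulTopEquivQuotSMulTopInner M x rs).toEquiv.symm.nontrivial
    have reg' : IsRegular (QuotSMulTop x M) rs :=
      ⟨h1.2, (Submodule.Quotient.nontrivial_iff.mp hnt').symm⟩
    have ih' := ih reg'
    have step := Module.supportDim_quotSMulTop_succ_le_of_notMem_minimalPrimes (M := M) (x := x)
      (fun p hp => h1.1.notMem_of_mem_minimalPrimes hp)
    calc ((x :: rs).length : WithBot ℕ∞) = (rs.length : WithBot ℕ∞) + 1 := by
          rw [List.length_cons, Nat.cast_succ]
      _ ≤ Module.supportDim R (QuotSMulTop x M) + 1 := add_le_add ih' le_rfl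
      _ ≤ Module.supportDim R M := step

/-- **A regular sequence in a commutative ring has length `≤` the Krull dimension** (`Supp R = Spec R`). Adapted from
`Cruxes/BlochSeedDiscOne/SeedCheckerOneAnchor.lean` §14.0. [cite: GortzWedhorn2023, Def. 19.19] -/
theorem length_le_ringKrullDim_of_isRegular {R : Type*} [CommRing R] (rs : List R) (reg : IsRegular R rs) :
    (rs.length : WithBot ℕ∞) ≤ ringKrullDim R := by
  rw [← Module.supportDim_self_eq_ringKrullDim]
  exact length_le_supportDim_of_isRegular rs reg

/-- The germ at a point of the image of a section of the kernel ideal of `i : Z ⟶ X` is a NON-UNIT of `𝒪_{X, i z}` (the stalk map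
is a ring map to the non-trivial local ring `𝒪_{Z,z}` killing it). Adapted from `Cruxes/BlochSeedDiscOne/SeedCheckerOneAnchor.lean`
§14.0. [cite: GortzWedhorn2023, Def. 19.19] -/
theorem germ_mem_maximalIdeal_of_mem_ker {X Z : Scheme.{u}} (i : Z ⟶ X) (U : X.affineOpens) (z : Z)
    (hx : i.base z ∈ (U : X.Opens)) {r : Γ(X, U)} (hr : r ∈ i.ker.ideal U) :
    X.presheaf.germ U (i.base z) hx r ∈ IsLocalRing.maximalIdeal (X.presheaf.stalk (i.base z)) := by
  rw [IsLocalRing.mem_maximalIdeal, mem_nonunits_iff]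
  intro hu
  have h0 : (i.app U).hom r = 0 := i.ideal_ker_le U hr
  have h1 := hu.map (i.stalkMap z).hom
  have h2 : (i.stalkMap z).hom (X.presheaf.germ U (i.base z) hx r) = 0 := by
    have := Scheme.Hom.germ_stalkMap_apply i U z hx r
    rw [show (i.app U) r = 0 from h0, map_zero] at this
    exact this
  rw [h2, isUnit_zero_iff] at h1
  exact zero_ne_one h1

/-- **THE CODIMENSION LAW OF REGULAR IMMERSIONS**: a point of the image of a regular immersion `i : Z ⟶ X` of codimension `n`
(closed lci subscheme of constant codimension `n`, `IsRegularImmersionOfCodim`) has codimension `≥ n` in `X` — `n ≤ coheight (i z)`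
for the order `x ≤ y ↔ y ⤳ x` on scheme points (`coheight x = dim 𝒪_{X,x}`, Mathlib `ringKrullDim_stalk_eq_coheight`). Every scheme:
the `n` weakly regular generators of the ideal on an affine neighbourhood localise (`IsAffineOpen.isLocalization_stalk`) into
`𝔪_{X, i z}` (`germ_mem_maximalIdeal_of_mem_ker`), hence form a REGULAR sequence (`IsWeaklyRegular.isRegular_of_isLocalization_of_mem`)
of length `≤ dim 𝒪_{X, i z}` (`length_le_ringKrullDim_of_isRegular`). This is the codimension-of-points clause of `HasBlochSeedAt`,
which is therefore implied by its lci clause. Adapted from `Cruxes/BlochSeedDiscOne/SeedCheckerOneAnchor.lean` §14.0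
(`codimOfRegularImmersion`). [cite: GortzWedhorn2023, Def. 19.19 and Def. 19.23] [cite: BuchweitzFlenner2003, (8.1)] -/
theorem coheight_ge_of_isRegularImmersionOfCodim {X Z : Scheme.{u}} {i : Z ⟶ X} {n : ℕ} (h : IsRegularImmersionOfCodim i n) :
    ∀ x ∈ Set.range i.base, (n : ℕ∞) ≤ Order.coheight x := by
  intro x hx'
  obtain ⟨z, rfl⟩ := hx'
  obtain ⟨U, hxU, rs, hlen, hreg, hI⟩ := h.2 z
  letI : Algebra Γ(X, U) (X.presheaf.stalk (i.base z)) := (X.presheaf.germ U (i.base z) hxU).hom.toAlgebra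
  haveI := U.2.isLocalization_stalk ⟨i.base z, hxU⟩
  have mem : ∀ r ∈ rs, r ∈ (U.2.primeIdealOf ⟨i.base z, hxU⟩).asIdeal := by
    intro r hr
    rw [← IsLocalization.AtPrime.to_map_mem_maximal_iff (X.presheaf.stalk (i.base z))
      (U.2.primeIdealOf ⟨i.base z, hxU⟩).asIdeal r]
    have hrI : r ∈ i.ker.ideal U := by
      rw [← hI]
      exact Ideal.subset_span hr
    exact germ_mem_maximalIdeal_of_mem_ker i U z hxU hrI
  have reg := hreg.isRegular_of_isLocalization_of_mem (X.presheaf.stalk (i.base z))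
    (U.2.primeIdealOf ⟨i.base z, hxU⟩).asIdeal mem
  have hle := length_le_ringKrullDim_of_isRegular _ reg
  rw [List.length_map, hlen, AlgebraicGeometry.ringKrullDim_stalk_eq_coheight] at hle
  exact_mod_cast hle

end CodimLaw

/-! ## §2 Minimal clauses: a Bloch seed has four, an lci carrier three -/

section Minimal

variable {n : ℕ} {P : AbelianVariety ℂ} {h : complexBetti P.X 2} {w : complexBetti P.X (2 * n)}

/-- **`HasBlochSeedAt` in minimal form**: a Bloch seed for `q·hⁿ + w` on `P` IS a regular immersion `i : Z ↪ P` of codimension `n`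
with `Z` integral, Bloch-semiregular, supporting `q·hⁿ + w` — FOUR clauses; the `IsClosedImmersion` clause of the definition is
part of the lci clause (`IsRegularImmersionOfCodim.isClosedImmersion`) and the codimension-of-points clause is the codimension law
(§1). [cite: Bloch1972Semiregularity, Thm. (7.4) and Remark (7.5)] [cite: GortzWedhorn2023, Def. 19.23] -/
theorem hasBlochSeedAt_iff_four :
    HasBlochSeedAt n P h w ↔
      ∃ (Z : Scheme.{0}) (i : Z ⟶ P.X.left) (q : ℚ), IsRegularImmersionOfCodim i n ∧ AlgebraicGeometry.IsIntegral Z ∧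
        IsBlochSemiregular i (2 * n) n ∧
        ((q : ℚ) : ℂ) • cupPowTwo h n + w ∈ classesSupportedOn P.X (Set.range i.base) (2 * n) :=
  ⟨fun ⟨Z, i, q, _, hreg, hint, _, hsr, hσ⟩ => ⟨Z, i, q, hreg, hint, hsr, hσ⟩,
    fun ⟨Z, i, q, hreg, hint, hsr, hσ⟩ =>
      ⟨Z, i, q, hreg.isClosedImmersion, hreg, hint, coheight_ge_of_isRegularImmersionOfCodim hreg, hsr, hσ⟩⟩

/-- Constructor form of `hasBlochSeedAt_iff_four`: lci of codimension `n`, integral, Bloch-semiregular, supported class ⟹ a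
Bloch seed. [cite: Bloch1972Semiregularity, Remark (7.5)] -/
theorem hasBlochSeedAt_of_four {Z : Scheme.{0}} (i : Z ⟶ P.X.left) (q : ℚ) (hreg : IsRegularImmersionOfCodim i n)
    (hint : AlgebraicGeometry.IsIntegral Z) (hsr : IsBlochSemiregular i (2 * n) n)
    (hσ : ((q : ℚ) : ℂ) • cupPowTwo h n + w ∈ classesSupportedOn P.X (Set.range i.base) (2 * n)) :
    HasBlochSeedAt n P h w :=
  hasBlochSeedAt_iff_four.2 ⟨Z, i, q, hreg, hint, hsr, hσ⟩

/-- **A Bloch seed from a SMOOTH CONNECTED semiregular presentation**: lci of codimension `n`, smooth over `ℂ`, connected,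
Bloch-semiregular, supported class ⟹ a Bloch seed; integrality is the landed `isIntegral_of_smooth_of_connectedSpace` (Stacks 056S +
0357). The shape in which zero loci of regular sections / degeneracy loci of general maps to globally generated ample bundles
arrive (Kleiman–Bertini, Fulton–Lazarsfeld — neither in the tree). [cite: Bloch1972Semiregularity, Remark (7.5)]
[cite: StacksProject, Tag 056S and Tag 0357] -/
theorem hasBlochSeedAt_of_smooth_connected {Z : Scheme.{0}} (i : Z ⟶ P.X.left) (q : ℚ)
    (hreg : IsRegularImmersionOfCodim i n) (hsm : AlgebraicGeometry.Smooth (i ≫ P.X.hom)) (hconn : ConnectedSpace Z)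
    (hsr : IsBlochSemiregular i (2 * n) n)
    (hσ : ((q : ℚ) : ℂ) • cupPowTwo h n + w ∈ classesSupportedOn P.X (Set.range i.base) (2 * n)) :
    HasBlochSeedAt n P h w :=
  haveI := hsm
  hasBlochSeedAt_of_four i q hreg (isIntegral_of_smooth_of_connectedSpace (i ≫ P.X.hom)) hsr hσ

/-- **The lci CARRIER in minimal form (three clauses)**: a regular immersion of codimension `n` with `Z` integral supporting
`q·hⁿ + w` gives the body of the skeletons' `HasLciCarrierAt n P h w` (`Cruxes/BlochSeedsGeneric/Lines/pad4_cm_anchor.lean` §1 =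
`HasBlochSeedAt` with the semiregularity clause deleted; spelled out, the definition being skeleton-local).
[cite: Bloch1972Semiregularity, Remark (7.5)] [cite: GortzWedhorn2023, Def. 19.23] -/
theorem exists_lciCarrier_of_three {Z : Scheme.{0}} (i : Z ⟶ P.X.left) (q : ℚ) (hreg : IsRegularImmersionOfCodim i n)
    (hint : AlgebraicGeometry.IsIntegral Z)
    (hσ : ((q : ℚ) : ℂ) • cupPowTwo h n + w ∈ classesSupportedOn P.X (Set.range i.base) (2 * n)) :
    ∃ (Z : Scheme.{0}) (i : Z ⟶ P.X.left) (q : ℚ),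
      IsClosedImmersion i ∧ IsRegularImmersionOfCodim i n ∧ AlgebraicGeometry.IsIntegral Z ∧
      (∀ z ∈ Set.range i.base, (n : ℕ∞) ≤ Order.coheight z) ∧
      ((q : ℚ) : ℂ) • cupPowTwo h n + w ∈ classesSupportedOn P.X (Set.range i.base) (2 * n) :=
  ⟨Z, i, q, hreg.isClosedImmersion, hreg, hint, coheight_ge_of_isRegularImmersionOfCodim hreg, hσ⟩

end Minimal

/-! ## §3 Bridges on the polarisation class: ℚ-rescaling and `K`-symmetrisation -/

section Bridges

variable {n : ℕ} {P : AbelianVariety ℂ} {h : complexBetti P.X 2} {w : complexBetti P.X (2 * n)}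

/-- **ℚ-rescaling the class `h` does not change the seed predicate**: for a rational `c ≠ 0`,
`HasBlochSeedAt n P (c • h) w ↔ HasBlochSeedAt n P h w` — `(c·h)ⁿ = cⁿ·hⁿ` (`cupPowTwo_smul`), so `q·(c·h)ⁿ + w = (q·cⁿ)·hⁿ + w` with
`q·cⁿ ∈ ℚ`, and conversely with `q·c⁻ⁿ`; the subscheme is unchanged. [cite: HatcherAT2002, §3.2] [cite: Bloch1972Semiregularity, Remark (7.5)] -/
theorem hasBlochSeedAt_ratSmul_iff {c : ℚ} (hc : c ≠ 0) :
    HasBlochSeedAt n P (((c : ℚ) : ℂ) • h) w ↔ HasBlochSeedAt n P h w := by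
  constructor
  · rintro ⟨Z, i, q, hci, hreg, hint, hcoh, hsr, hσ⟩
    refine ⟨Z, i, q * c ^ n, hci, hreg, hint, hcoh, hsr, ?_⟩
    have hq : (((q * c ^ n : ℚ)) : ℂ) • cupPowTwo h n = ((q : ℚ) : ℂ) • cupPowTwo (((c : ℚ) : ℂ) • h) n := by
      rw [Literature.AlgebraicGeometry.Hyperkaehler.cupPowTwo_smul, smul_smul]
      push_cast
      rfl
    rw [hq]
    exact hσ
  · rintro ⟨Z, i, q, hci, hreg, hint, hcoh, hsr, hσ⟩
    refine ⟨Z, i, q / c ^ n, hci, hreg, hint, hcoh, hsr, ?_⟩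
    have hcn : ((c : ℚ) : ℂ) ^ n ≠ 0 := pow_ne_zero _ (by exact_mod_cast hc)
    have hq : (((q / c ^ n : ℚ)) : ℂ) • cupPowTwo (((c : ℚ) : ℂ) • h) n = ((q : ℚ) : ℂ) • cupPowTwo h n := by
      rw [Literature.AlgebraicGeometry.Hyperkaehler.cupPowTwo_smul, smul_smul]
      push_cast
      rw [div_mul_cancel₀ _ hcn]
    rw [hq]
    exact hσ

variable (ψ : P ⟶ P) {d : ℕ}

/-- **The `K`-symmetrised class of a `K`-symmetric class is `2d` times it**: if `ψ^*h = d·h` then `d·h + ψ^*h = (2d)·h`, the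
scalar written as the rational number `2d` (the shape consumed by `hasBlochSeedAt_ratSmul_iff` and
`Motives.isHyperbolicWeilType_smul_iff`). [cite: vanGeemen1994HodgeAV, Lemma 5.2 (1)] [cite: Markman2025SurveySecant, §11.5 Step 2] -/
theorem symmetrised_eq_smul (hsym : complexBetti.map ψ.hom.hom.hom 2 h = (d : ℂ) • h) :
    (d : ℂ) • h + complexBetti.map ψ.hom.hom.hom 2 h = (((2 * d : ℚ)) : ℂ) • h := by
  rw [hsym, ← add_smul]
  push_cast
  rw [two_mul]

variable {ψ}

/-- **Seed clause: `K`-symmetrised class versus `K`-symmetric class.** For `d ≥ 1` and a `K`-symmetric `h` (`ψ^*h = d·h`),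
`HasBlochSeedAt n P (d·h + ψ^*h) w ↔ HasBlochSeedAt n P h w` (`symmetrised_eq_smul` and `hasBlochSeedAt_ratSmul_iff` with `c = 2d`).
[cite: Bloch1972Semiregularity, Remark (7.5)] [cite: vanGeemen1994HodgeAV, Lemma 5.2 (1)] -/
theorem hasBlochSeedAt_symmetrised_iff (hd : 0 < d) (hsym : complexBetti.map ψ.hom.hom.hom 2 h = (d : ℂ) • h) :
    HasBlochSeedAt n P ((d : ℂ) • h + complexBetti.map ψ.hom.hom.hom 2 h) w ↔ HasBlochSeedAt n P h w := by
  rw [symmetrised_eq_smul ψ hsym]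
  exact hasBlochSeedAt_ratSmul_iff (by positivity)

/-- **Hyperbolicity clause: `K`-symmetrised class versus `K`-symmetric class.** For `d ≥ 1` and a `K`-symmetric `h`,
`IsHyperbolicWeilType P ψ n (d·h + ψ^*h) ↔ IsHyperbolicWeilType P ψ n h` (`Q_{c h} = c^{2n-1} Q_h`, the tree's
`Motives.isHyperbolicWeilType_smul_iff`). [cite: vanGeemen1994HodgeAV, Lemma 5.2 and 5.4 (5.4.1)] -/
theorem isHyperbolicWeilType_symmetrised_iff (hd : 0 < d) (hsym : complexBetti.map ψ.hom.hom.hom 2 h = (d : ℂ) • h) :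
    IsHyperbolicWeilType P ψ n ((d : ℂ) • h + complexBetti.map ψ.hom.hom.hom 2 h) ↔ IsHyperbolicWeilType P ψ n h := by
  rw [symmetrised_eq_smul ψ hsym]
  have hc : (((2 * d : ℚ)) : ℂ) ≠ 0 := by
    have : (2 * d : ℚ) ≠ 0 := by positivity
    exact_mod_cast this
  exact Motives.isHyperbolicWeilType_smul_iff hc

end Bridges

/-! ## §4 Stub-shaped wrappers at general `(P, ψ, d, n)` -/

section StubShape

variable {n : ℕ} {P : AbelianVariety ℂ} (ψ : P ⟶ P) (d : ℕ)

/-- **The rung stub's body from a four-clause seed (general `(P, ψ, d, n)`).** Given a projective embedding `e` with a rational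
`a ≠ 0` making `(P, ψ)` hyperbolic in half-dimension `n` for `h_K = d·e^*a + ψ^*e^*a`, a non-zero rational class `w` of the Weil plane,
and a regular immersion `i : Z ↪ P` of codimension `n`, integral, Bloch-semiregular, supporting `q·h_Kⁿ + w`: the conjunction
«`∃ e a w`, `a` rational `≠ 0`, hyperbolic for `h_K`, `w ∈ W_K` rational `≠ 0`, `HasBlochSeedAt n P h_K w`» holds. At
`P := pad4Anchor E₀`, `ψ := pad4Action E₀ ψ₀`, `n := 4` this conclusion is LITERALLY the body of `stub_rung_pad4_seedAt d hd E₀ ψ₀ hE hψ`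
of `Cruxes/BlochSeedsGeneric/Lines/pad4_cm_anchor.lean` (and of its `d = 1`, `d = 3` siblings), the skeleton's `symH`, `pad4Anchor`,
`pad4Action` being reducible abbreviations. [cite: Bloch1972Semiregularity, Remark (7.5)] [cite: Markman2025SecantWeil, §1.5] -/
theorem exists_seed_stubShape_of_four (e : ProjectiveEmbedding P.X) (a : complexBetti (projectiveSpace e.n ℂ) 2)
    (ha : IsRationalClass a) (ha0 : a ≠ 0)
    (hhyp : IsHyperbolicWeilType P ψ n
      ((d : ℂ) • complexBetti.map e.ι 2 a + complexBetti.map ψ.hom.hom.hom 2 (complexBetti.map e.ι 2 a)))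
    (w : complexBetti P.X (2 * n)) (hwW : w ∈ weilClassesOf P ψ n d) (hwr : IsRationalClass w) (hw0 : w ≠ 0)
    {Z : Scheme.{0}} (i : Z ⟶ P.X.left) (q : ℚ) (hreg : IsRegularImmersionOfCodim i n)
    (hint : AlgebraicGeometry.IsIntegral Z) (hsr : IsBlochSemiregular i (2 * n) n)
    (hσ : ((q : ℚ) : ℂ) •
        cupPowTwo ((d : ℂ) • complexBetti.map e.ι 2 a + complexBetti.map ψ.hom.hom.hom 2 (complexBetti.map e.ι 2 a)) n + w ∈
        classesSupportedOn P.X (Set.range i.base) (2 * n)) :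
    ∃ (e : ProjectiveEmbedding P.X) (a : complexBetti (projectiveSpace e.n ℂ) 2) (w : complexBetti P.X (2 * n)),
      IsRationalClass a ∧ a ≠ 0 ∧
      IsHyperbolicWeilType P ψ n
        ((d : ℂ) • complexBetti.map e.ι 2 a + complexBetti.map ψ.hom.hom.hom 2 (complexBetti.map e.ι 2 a)) ∧
      w ∈ weilClassesOf P ψ n d ∧ IsRationalClass w ∧ w ≠ 0 ∧
      HasBlochSeedAt n P
        ((d : ℂ) • complexBetti.map e.ι 2 a + complexBetti.map ψ.hom.hom.hom 2 (complexBetti.map e.ι 2 a)) w :=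
  ⟨e, a, w, ha, ha0, hhyp, hwW, hwr, hw0, hasBlochSeedAt_of_four i q hreg hint hsr hσ⟩

/-- **The rung stub's body in the DESIGNER'S form (general `(P, ψ, d, n)`, `d ≥ 1`).** If the hyperplane class `h = e^*a` of the
embedding is `K`-SYMMETRIC (`ψ^*h = d·h` — the tree's symmetric Segre embeddings, `Motives.exists_symmetricSegreEmbedding`, and the
re-embedding `Theorems.exists_projectiveEmbedding_symmetrised` produce such `e, a`), then hyperbolicity FOR `h` and a Bloch seed FOR `h`
(with a non-zero rational Weil class `w`) give the stub's conjunction for the `K`-symmetrised class `h_K = d·h + ψ^*h = 2d·h` (§3).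
[cite: vanGeemen1994HodgeAV, Lemma 5.2 and 5.4 (5.4.1)] [cite: Bloch1972Semiregularity, Remark (7.5)] -/
theorem exists_seed_stubShape_of_symmetric (hd : 0 < d) (e : ProjectiveEmbedding P.X) (a : complexBetti (projectiveSpace e.n ℂ) 2)
    (ha : IsRationalClass a) (ha0 : a ≠ 0)
    (hsym : complexBetti.map ψ.hom.hom.hom 2 (complexBetti.map e.ι 2 a) = (d : ℂ) • complexBetti.map e.ι 2 a)
    (hhyp : IsHyperbolicWeilType P ψ n (complexBetti.map e.ι 2 a))
    (w : complexBetti P.X (2 * n)) (hwW : w ∈ weilClassesOf P ψ n d) (hwr : IsRationalClass w) (hw0 : w ≠ 0)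
    (hseed : HasBlochSeedAt n P (complexBetti.map e.ι 2 a) w) :
    ∃ (e : ProjectiveEmbedding P.X) (a : complexBetti (projectiveSpace e.n ℂ) 2) (w : complexBetti P.X (2 * n)),
      IsRationalClass a ∧ a ≠ 0 ∧
      IsHyperbolicWeilType P ψ n
        ((d : ℂ) • complexBetti.map e.ι 2 a + complexBetti.map ψ.hom.hom.hom 2 (complexBetti.map e.ι 2 a)) ∧
      w ∈ weilClassesOf P ψ n d ∧ IsRationalClass w ∧ w ≠ 0 ∧
      HasBlochSeedAt n P
        ((d : ℂ) • complexBetti.map e.ι 2 a + complexBetti.map ψ.hom.hom.hom 2 (complexBetti.map e.ι 2 a)) w :=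
  ⟨e, a, w, ha, ha0, (isHyperbolicWeilType_symmetrised_iff hd hsym).2 hhyp, hwW, hwr, hw0,
    (hasBlochSeedAt_symmetrised_iff hd hsym).2 hseed⟩

/-- **The carrier stub's body from a three-clause carrier (general `(P, ψ, d, n)`).** Given `e`, a rational `a ≠ 0`, a non-zero
rational Weil class `w`, and a regular immersion `i : Z ↪ P` of codimension `n` with `Z` integral supporting `q·h_Kⁿ + w`: the
conjunction «`∃ e a w`, `a` rational `≠ 0`, `w ∈ W_K` rational `≠ 0`, lci carrier of `q·h_Kⁿ + w`» holds — at `P := pad4Anchor E₀`,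
`ψ := pad4Action E₀ ψ₀`, `n := 4` LITERALLY the body of `stub_pad4_carrier d hd E₀ ψ₀ hE hψ` (`HasLciCarrierAt` unfolds by `rfl`). The
`d = 1` hand's `exists_carrier_stubShape_of_smooth_connected` is the smooth-connected variant with the (now redundant) codimension
binder. [cite: Bloch1972Semiregularity, Remark (7.5)] [cite: Fulton1998, Ex. 14.1.1 and §14.4] -/
theorem exists_carrier_stubShape_of_three (e : ProjectiveEmbedding P.X) (a : complexBetti (projectiveSpace e.n ℂ) 2)
    (ha : IsRationalClass a) (ha0 : a ≠ 0)
    (w : complexBetti P.X (2 * n)) (hwW : w ∈ weilClassesOf P ψ n d) (hwr : IsRationalClass w) (hw0 : w ≠ 0)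
    {Z : Scheme.{0}} (i : Z ⟶ P.X.left) (q : ℚ) (hreg : IsRegularImmersionOfCodim i n)
    (hint : AlgebraicGeometry.IsIntegral Z)
    (hσ : ((q : ℚ) : ℂ) •
        cupPowTwo ((d : ℂ) • complexBetti.map e.ι 2 a + complexBetti.map ψ.hom.hom.hom 2 (complexBetti.map e.ι 2 a)) n + w ∈
        classesSupportedOn P.X (Set.range i.base) (2 * n)) :
    ∃ (e : ProjectiveEmbedding P.X) (a : complexBetti (projectiveSpace e.n ℂ) 2) (w : complexBetti P.X (2 * n)),
      IsRationalClass a ∧ a ≠ 0 ∧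
      w ∈ weilClassesOf P ψ n d ∧ IsRationalClass w ∧ w ≠ 0 ∧
      ∃ (Z : Scheme.{0}) (i : Z ⟶ P.X.left) (q : ℚ),
        IsClosedImmersion i ∧ IsRegularImmersionOfCodim i n ∧ AlgebraicGeometry.IsIntegral Z ∧
        (∀ z ∈ Set.range i.base, (n : ℕ∞) ≤ Order.coheight z) ∧
        ((q : ℚ) : ℂ) •
            cupPowTwo ((d : ℂ) • complexBetti.map e.ι 2 a + complexBetti.map ψ.hom.hom.hom 2 (complexBetti.map e.ι 2 a)) n +
            w ∈ classesSupportedOn P.X (Set.range i.base) (2 * n) :=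
  ⟨e, a, w, ha, ha0, hwW, hwr, hw0, exists_lciCarrier_of_three i q hreg hint hσ⟩

end StubShape


end Summit.HodgeConjecture.HodgeConjecture.Theorems

end
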